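import Summits.ResolutionOfSingularities.ResolutionOfSingularities.Theorems.EquisingularLiftEquisingularLiftNatModelPointStep
import Summits.ResolutionOfSingularities.ResolutionOfSingularities.Theorems.EquisingularLiftEquisingularLiftNatSectionGoodPoint
import Mathlib.RingTheory.Flat.TorsionFree
import HarnessLib

/-!
# [OURS · L1 W4.5(b) · EL♮(3)] HSUB(ReachTC⁺) — GOOD REDUCTION AT A POINT OF A FLAT (not necessarily integral or regular) `O`-scheme,
# read through the model square: the LOCAL form of res-D-pv-029's `goodAt_of_model` used for Hensel sections ON the in-carrier surface
# (registered stub `stub_elnat_tcPlusPointResolution`; driver `hsub_reachTCPlus_of_invariant` p526242, brick `inv_step_regular`)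

Crux `EquisingularLiftNat` = stmt-ResolutionOfSingularities-20038 (child EL♮(3) = stmt-ResolutionOfSingularities-20148), route
EquisingularLift, line `sections`. Helper file `--supports stmt-ResolutionOfSingularities-20148 --as helper` by res-L1-w45b-stub-1
(HSUB(ReachTC⁺) assembly, res-L1-w45b-lead-2 GO 2026-08-27T10:45:46Z). HONEST FRAMING: OURS (cell res-hironaka, slot W4.5(b)); NOT a
statement of any manuscript; AI-written, weaker than expert review. No `sorry`; standard axioms.

WHY. The inner steps of v7 (TC⁺) blow up sections of the stage `X` that LIE ON the in-carrier surface `D = V(𝓢 ⊔ K)` through a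
REGULAR point `y` of the running curve (res-L1-w45b-lead-2 TARGET-TCPLUS: «Hensel sections ON `V(G̃)` at the regular points»). Such a
section comes from the tree's `exists_section_of_goodAt` applied to `D → Spec O` — flat, separated, of finite presentation, but
NEITHER integral NOR globally regular (the centred member's `D` is singular at its `O`-point over `q′`, by design) — so res-D-pv-029's
`goodAt_of_model` (p510112; `X'` integral, `Scheme.IsRegular X'`, dominant) does not apply verbatim. Here:

* `Γgerm_ne_zero_of_flat` — for a FLAT `r : X → Spec O` over a DVR and any point `y`, the germ of `r♯(ϖ)` (`ϖ ≠ 0`) at `y` is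
  non-zero (the stalk is flat over the localisation of `O` at `r y`, hence `ϖ`-torsion-free, and non-trivial);
* **`goodAt_of_model_of_isRegularLocalRing`** — `r : X → Spec O` flat, a model square `IsPullback j t r (Spec θ)` (`θ : O ↠ k`),
  `x ∈ F` with `𝒪_{X, j x}` regular AND `𝒪_{F,x}` regular ⇒ `GoodAt r (j x)` (= res-D-pv-029's proof of `goodAt_of_model` with the
  global hypotheses localised: regularity only at `j x`, the non-vanishing of the germ from flatness instead of integrality);
* `exists_section_of_model_of_isRegularLocalRing` — hence, for `r` moreover separated and locally of finite presentation, `O` complete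
  with algebraically closed residue field and `x` closed: a SECTION of `r` through `j x` with regular, `O`-flat centre (tree
  `exists_section_of_goodAt`, p-era o1/lead files).

References: res-D-pv-029 …NatModelPointStep (p510112) `goodAt_of_model`; tree `exists_section_of_goodAt` (…NatSectionGoodPoint),
`goodAt_of_isRegularLocalRing_fibre` (…GoodAtOfRegularFibre); H. Matsumura, *Commutative Ring Theory*, Thm. 14.2; EGA IV 18.5.17.
-/

set_option linter.dupNamespace false -- mandated namespace `Summit.<Summit>.<Problem>` of this single-conjunct summit
set_option linter.overlappingInstances false -- signatures carry `[IsDomain O] [IsDiscreteValuationRing O]`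

noncomputable section

open CategoryTheory CategoryTheory.Limits AlgebraicGeometry TopologicalSpace Topology IsLocalRing
open Literature.AlgebraicGeometry.Resolution
open AlgebraicGeometry.Scheme.IdealSheafData
open Summit.ResolutionOfSingularities.ResolutionOfSingularities.Theses.EquisingularLift.Split
open Summit.ResolutionOfSingularities.ResolutionOfSingularities.Cruxes.EquisingularLift.StrataSplit

namespace Summit.ResolutionOfSingularities.ResolutionOfSingularities.Cruxes.EquisingularLiftNat.Sections

/-- **The germ of the uniformizer on a flat `O`-scheme is non-zero.** For `r : X → Spec O` flat over a DVR, `ϖ ≠ 0` in `O` and any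
point `y` of `X`, the germ at `y` of `r♯(ϖ)` is non-zero: the stalk `𝒪_{X,y}` is flat over `𝒪_{Spec O, r y}` (a localisation of the
domain `O`, in which `ϖ ≠ 0` is a nonzerodivisor), hence `ϖ`-torsion-free, and it is a non-trivial local ring. [folklore] -/
theorem Γgerm_ne_zero_of_flat (O : Type) [CommRing O] [IsDomain O] {X : Scheme.{0}} (r : X ⟶ Spec (.of O)) [Flat r]
    (y : X) {ϖ : O} (hϖ : ϖ ≠ 0) :
    (X.presheaf.Γgerm y).hom (r.appTop.hom ((Scheme.ΓSpecIso (CommRingCat.of O)).inv.hom ϖ)) ≠ 0 := by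
  set R := (Spec (.of O)).presheaf.stalk (r y)
  set S := X.presheaf.stalk y
  letI : Algebra R S := (r.stalkMap y).hom.toAlgebra
  letI : Algebra O R := StructureSheaf.stalkAlgebra O (r y)
  haveI : IsLocalization.AtPrime R (r y).asIdeal := StructureSheaf.IsLocalization.to_stalk O (r y)
  have hgalg : algebraMap R S (algebraMap O R ϖ) =
      (X.presheaf.Γgerm y).hom (r.appTop.hom ((Scheme.ΓSpecIso (CommRingCat.of O)).inv.hom ϖ)) := by
    rw [algebraMap_stalk_eq_Γgerm]
    exact stalkMap_Γgerm_apply' r y _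
  rw [← hgalg]
  -- flatness of the stalk map
  haveI : Module.Flat R S := (Flat.stalkMap r y)
  -- `ϖ` is a nonzerodivisor of the domain `R`
  have hM : (r y).asIdeal.primeCompl ≤ nonZeroDivisors O := Ideal.primeCompl_le_nonZeroDivisors _
  haveI : IsDomain R := IsLocalization.isDomain_of_le_nonZeroDivisors (M := (r y).asIdeal.primeCompl) R hM
  have hϖR : algebraMap O R ϖ ≠ 0 := fun h =>
    hϖ (IsLocalization.injective R hM (h.trans (map_zero _).symm))
  have hreg : IsSMulRegular S (algebraMap O R ϖ) :=
    Module.Flat.isSMulRegular_of_nonZeroDivisors (mem_nonZeroDivisors_of_ne_zero hϖR)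
  intro h0
  have h1 : algebraMap O R ϖ • (1 : S) = algebraMap O R ϖ • (0 : S) := by
    rw [smul_zero, Algebra.smul_def, mul_one, h0]
  exact one_ne_zero (hreg h1)

/-- **Good reduction read through the model, LOCAL form.** `O` a DVR, `θ : O ↠ k`, `r : X → Spec O` FLAT, a model square
`IsPullback j t r (Spec θ)`; if `𝒪_{X, j x}` is a regular local ring and `𝒪_{F, x}` is a regular local ring (the special fibre is
regular at `x`), then `r` has good reduction at `j x` (`GoodAt`). res-D-pv-029's `goodAt_of_model` with its global hypotheses
(`X` integral and regular, `r` dominant) replaced by the local ones. [cite: Matsumura1987, Thm. 14.2] -/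
theorem goodAt_of_model_of_isRegularLocalRing (O : Type) [CommRing O] [IsDomain O] [IsDiscreteValuationRing O] (k : Type) [Field k]
    (θ : O →+* k) (hθ : Function.Surjective θ) (X F : Scheme.{0}) (r : X ⟶ Spec (.of O)) [Flat r]
    (j : F ⟶ X) (t : F ⟶ Spec (.of k)) (hsq : IsPullback j t r (Spec.map (CommRingCat.ofHom θ))) (x : F)
    (hreg : IsRegularLocalRing (X.presheaf.stalk (j x))) (hx : IsRegularLocalRing (F.presheaf.stalk x)) :
    GoodAt r (j x) := by
  -- adapted from `goodAt_of_model` (…NatModelPointStep, res-D-pv-029)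
  haveI : IsClosedImmersion (Spec.map (CommRingCat.ofHom θ)) := IsClosedImmersion.spec_of_surjective _ hθ
  haveI hjci : IsClosedImmersion j := MorphismProperty.IsStableUnderBaseChange.of_isPullback hsq.flip inferInstance
  refine goodAt_of_isRegularLocalRing_fibre O X r (j x) hreg (fun ϖ hϖ => Γgerm_ne_zero_of_flat O r (j x) hϖ.ne_zero)
    (fun z hz => ?_)
  obtain ⟨t', hsq'⟩ := isPullback_residue_of_model θ hθ r j t hsq
  set e := hsq'.isoPullback with he
  have hefst : e.hom ≫ pullback.fst r (Spec.map (CommRingCat.ofHom (IsLocalRing.residue O))) = j := hsq'.isoPullback_hom_fst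
  obtain ⟨y, rfl⟩ := e.hom.homeomorph.surjective z
  have hy : j y = j x :=
    calc j y = (e.hom ≫ pullback.fst r (Spec.map (CommRingCat.ofHom (IsLocalRing.residue O)))) y := by rw [hefst]
      _ = pullback.fst r (Spec.map (CommRingCat.ofHom (IsLocalRing.residue O))) (e.hom y) := Scheme.Hom.comp_apply _ _ _
      _ = j x := hz
  have hyx : y = x := hjci.isClosedEmbedding.injective hy
  subst hyx
  exact (isRegularLocalRing_stalk_iff_of_iso e y).mpr hx

/-- **A section through a regular point of the special fibre of a flat `O`-scheme which is regular there.** `O` a complete DVR with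
algebraically closed residue field, `θ : O ↠ k`, `r : X → Spec O` flat, separated, locally of finite presentation, a model square
`IsPullback j t r (Spec θ)`, `x ∈ F` CLOSED with `𝒪_{X, j x}` and `𝒪_{F, x}` regular ⇒ there is a section `s` of `r` with
`s(𝔪) = j x`, regular `O`-flat centre `V(ker s)`, and no other special point on it. For v7 (TC⁺): `X := D = V(𝓢 ⊔ K)` the in-carrier
surface, `x` a regular point of the running curve — the HENSEL SECTION ON `D`. [cite: Grothendieck1967, Thm. 18.5.17] -/
theorem exists_section_of_model_of_isRegularLocalRing (O : Type) [CommRing O] [IsDomain O] [IsDiscreteValuationRing O]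
    [IsAdicComplete (maximalIdeal O) O] [IsAlgClosed (ResidueField O)] (k : Type) [Field k]
    (θ : O →+* k) (hθ : Function.Surjective θ) (X F : Scheme.{0}) (r : X ⟶ Spec (.of O)) [Flat r] [IsSeparated r]
    [LocallyOfFinitePresentation r]
    (j : F ⟶ X) (t : F ⟶ Spec (.of k)) (hsq : IsPullback j t r (Spec.map (CommRingCat.ofHom θ))) (x : F)
    (hxcl : IsClosed ({x} : Set F))
    (hreg : IsRegularLocalRing (X.presheaf.stalk (j x))) (hx : IsRegularLocalRing (F.presheaf.stalk x)) :
    ∃ s : Spec (.of O) ⟶ X, s ≫ r = 𝟙 _ ∧ s (closedPoint O) = j x ∧ Scheme.IsRegular s.ker.subscheme ∧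
      Flat (s.ker.subschemeι ≫ r) ∧ ∀ y : X, r y = closedPoint O → y ≠ j x → y ∉ (s.ker.support : Set X) := by
  haveI : IsClosedImmersion (Spec.map (CommRingCat.ofHom θ)) := IsClosedImmersion.spec_of_surjective _ hθ
  haveI hjci : IsClosedImmersion j := MorphismProperty.IsStableUnderBaseChange.of_isPullback hsq.flip inferInstance
  have hjxcl : IsClosed ({j x} : Set X) := by
    have h := hjci.isClosedEmbedding.isClosedMap _ hxcl
    rwa [Set.image_singleton] at h
  have hrx : r (j x) = closedPoint O := by
    have h1 : j x ∈ Set.range j := ⟨x, rfl⟩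
    rw [range_eq_preimage_of_isPullback hsq, range_specMap_of_surjective_of_field θ hθ] at h1
    exact h1
  exact exists_section_of_goodAt O X r (j x) hjxcl hrx (goodAt_of_model_of_isRegularLocalRing O k θ hθ X F r j t hsq x hreg hx)

end Summit.ResolutionOfSingularities.ResolutionOfSingularities.Cruxes.EquisingularLiftNat.Sections

end
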